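import Mathlib
import Literature.Analysis.FluidPDE.EulerReynoldsLadderGluingLimit
import Literature.Analysis.FluidPDE.WeaklyDivFreeRemovablePoint
import HarnessLib

/-!
# Ladder gluing of steady Euler–Reynolds subsolutions, III: the glued velocity is weakly
# divergence free across the sphere and at the sink

Analysis/FluidPDE support file (everything proved; no definitions, no named facts). Third of the
`EulerReynoldsLadderGluing*` files (tool T8 of the free-space sink completion, route PointSink of
the anomalous-dissipation summit, stub `stub_freeSpaceSinkCompletion`, crux
stmt-AnomalousDissipation-19035); the velocity analogue of part II
(`EulerReynoldsLadderGluingLimit`). Inside the ball `|x| < r₀` the glued velocity `U` equals a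
rough field `V` (an `L¹_loc` cone off the origin); on `{r₀ < |x|}` it is `C¹` with `div U = 0`
classically; and on shells `s_N < |x| < s'_N ↓ ∂B_{r₀}` of the pure layers it coincides with the
layer velocities `u_N`, which are `C¹` and divergence free on `{d_N < |x|}`, `d_N → 0`, and
converge to `V` in `L¹` on shells.

* `integral_inner_gradient_eq_zero_of_ladder` — **matching across the sphere**:
  `∫ ⟪U, ∇θ⟫ = 0` for every smooth `θ` compactly supported in `ℝ³ ∖ {0}`. A sphere is NOT
  removable for the weak divergence of a general `L¹_loc` field (normal jumps), so the layer
  structure is genuinely used: with a radial cut-off `χ = 1 - ψ` across a shell of the pure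
  layer `N`, `∫ χ⟪U, ∇θ⟫ = -∫ θ⟪U, ∇χ⟫ = -∫ θ⟪u_N, ∇χ⟫ = ∫ χ⟪u_N, ∇θ⟫ = -∫ ψ⟪u_N, ∇θ⟫`
  (`∫ ⟪u_N, ∇θ⟫ = 0`), so `∫ ⟪U, ∇θ⟫ = ∫ ψ ⟪U - u_N, ∇θ⟫ → 0` (thin shells at the null sphere,
  `u_N → V` in `L¹` on shells, `U = V` inside).
* `integral_inner_gradient_eq_zero_of_ladder_of_sq` — if moreover `|U|² ∈ L¹_loc(ℝ³)` the origin
  is removable (`integral_inner_gradient_eq_zero_of_puncture`, tree), giving clause 9 of the stub: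
  `∫ ⟪U, ∇θ⟫ = 0` for ALL smooth compactly supported `θ`.

## Mathlib / tree search

As in part II; tree: `integrable_inner_gradient`, `integral_inner_gradient_eq_zero_of_puncture`
(`WeaklyDivFreeRemovablePoint`), part I's vector IBP. Nothing comparable exists
(`lean search 'inner_gradient_eq_zero_of'`, 2026-08-17).

## References

* G. P. Galdi, *An Introduction to the Mathematical Theory of the Navier–Stokes Equations*
  (2011), §III.2–III.4 (weakly divergence-free fields, cut-offs). [Galdi2011]
* C. De Lellis, L. Székelyhidi Jr., Arch. Ration. Mech. Anal. 195 (2010) 225–260, §2.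
  [DeLellisSzekelyhidi2010]
-/

noncomputable section

open MeasureTheory Filter Topology Set Metric Function
open scoped RealInnerProductSpace ContDiff

namespace Literature.Analysis.FluidPDE

namespace EulerReynoldsLadder

/-- **Matching across the sphere without traces (velocity form).** Let `U` be locally
integrable on `ℝ³`, `V` locally integrable off the origin, `U = V` on `|x| < r₀`, `U ∈ C¹` with
`div U = 0` on `{r₀ < |x|}`; let `u_N ∈ C¹({d_N < |x|})` be divergence free there, `U = u_N` on
`s_N < |x| < s'_N` with `r₀ < s_N < s'_N`, `d_N → 0`, `s'_N → r₀`, and `∫_{a<|x|<b} |u_N - V| → 0`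
for all `0 < a < b`. Then `∫ ⟪U, ∇θ⟫ = 0` for every smooth `θ` compactly supported in
`ℝ³ ∖ {0}`. [folklore] -/
theorem integral_inner_gradient_eq_zero_of_ladder {r₀ : ℝ} (hr₀ : 0 < r₀)
    {V U : EuclideanSpace ℝ (Fin 3) → EuclideanSpace ℝ (Fin 3)}
    (hU : LocallyIntegrable U volume) (hV : LocallyIntegrableOn V {x | x ≠ 0} volume)
    (hUV : ∀ x, ‖x‖ < r₀ → U x = V x)
    (hUs : ContDiffOn ℝ 1 U {x | r₀ < ‖x‖})
    (hUdiv : ∀ x : EuclideanSpace ℝ (Fin 3), r₀ < ‖x‖ → VectorCalculus.divergence U x = 0)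
    {u : ℕ → EuclideanSpace ℝ (Fin 3) → EuclideanSpace ℝ (Fin 3)} {d s s' : ℕ → ℝ}
    (hu : ∀ N, ContDiffOn ℝ 1 (u N) {x | d N < ‖x‖})
    (hudiv : ∀ (N : ℕ) (x : EuclideanSpace ℝ (Fin 3)), d N < ‖x‖ →
      VectorCalculus.divergence (u N) x = 0)
    (hrs : ∀ N, r₀ < s N) (hss' : ∀ N, s N < s' N)
    (hd : Tendsto d atTop (𝓝 0)) (hs' : Tendsto s' atTop (𝓝 r₀))
    (hagree : ∀ (N : ℕ) (x : EuclideanSpace ℝ (Fin 3)), s N < ‖x‖ → ‖x‖ < s' N → U x = u N x)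
    (hconv : ∀ a b : ℝ, 0 < a → a < b → Tendsto (fun N =>
      ∫ x in {x : EuclideanSpace ℝ (Fin 3) | a < ‖x‖ ∧ ‖x‖ < b}, ‖u N x - V x‖) atTop (𝓝 0))
    {θ : EuclideanSpace ℝ (Fin 3) → ℝ}
    (hθ : FunctionSpaces.IsTestFunctionOn
      ⟨{x : EuclideanSpace ℝ (Fin 3) | x ≠ 0}, isOpen_ne⟩ θ) :
    ∫ x, ⟪U x, gradient θ x⟫ = 0 := by
  have hθs : ContDiff ℝ 1 θ := hθ.contDiff.of_le (by exact_mod_cast le_top)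
  have hθc : HasCompactSupport θ := hθ.hasCompactSupport
  -- Step 0: the test function lives in a shell `a < |x| < b`, `a < r₀ < r₀ + 1 ≤ b`
  obtain ⟨δ, hδ, hδθ⟩ : ∃ δ > 0, ∀ x : EuclideanSpace ℝ (Fin 3), x ∈ tsupport θ → δ ≤ ‖x‖ := by
    have h0 : (0 : EuclideanSpace ℝ (Fin 3)) ∈ (tsupport θ)ᶜ := fun h => hθ.tsupport_subset h rfl
    obtain ⟨δ, hδ, hball⟩ := Metric.isOpen_iff.1 (isClosed_tsupport θ).isOpen_compl 0 h0
    refine ⟨δ, hδ, fun x hx => ?_⟩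
    by_contra h
    exact hball (mem_ball_zero_iff.2 (not_le.1 h)) hx
  obtain ⟨b₀, hb₀⟩ := hθc.isCompact.isBounded.subset_ball (0 : EuclideanSpace ℝ (Fin 3))
  set a : ℝ := min δ r₀ / 2 with ha
  have ha0 : 0 < a := by positivity
  have haδ : a < δ := by have := min_le_left δ r₀; linarith
  have har : a < r₀ := by have := min_le_right δ r₀; linarith
  set b : ℝ := max b₀ (r₀ + 1) with hb
  have hb1 : r₀ + 1 ≤ b := le_max_right _ _
  have hab : a < b := by linarith
  have hθa : ∀ x, x ∈ tsupport θ → a < ‖x‖ := fun x hx => lt_of_lt_of_le haδ (hδθ x hx)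
  have hθb : ∀ x, x ∈ tsupport θ → ‖x‖ < b := fun x hx =>
    lt_of_lt_of_le (mem_ball_zero_iff.1 (hb₀ hx)) (le_max_left _ _)
  -- the derivative of `θ`
  obtain ⟨K, hK⟩ := (hθ.contDiff.continuous_fderiv (by simp)).bounded_above_of_compact_support
    (hθc.fderiv (𝕜 := ℝ))
  have hK0 : 0 ≤ K := (norm_nonneg _).trans (hK 0)
  have hDθ : ∀ x v : EuclideanSpace ℝ (Fin 3), |⟪v, gradient θ x⟫| ≤ K * ‖v‖ := by
    intro x v
    rw [inner_gradient_eq_fderiv, ← Real.norm_eq_abs]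
    exact (ContinuousLinearMap.le_opNorm _ _).trans (mul_le_mul_of_nonneg_right (hK x) (norm_nonneg _))
  have hDθ0 : ∀ x, x ∉ tsupport θ → gradient θ x = 0 := fun x hx => by
    rw [gradient, fderiv_of_notMem_tsupport ℝ hx, map_zero]
  -- the integrand `G = ⟪U, ∇θ⟫` and the defect `D = |U - V|`
  set G : EuclideanSpace ℝ (Fin 3) → ℝ := fun x => ⟪U x, gradient θ x⟫ with hG
  set D : EuclideanSpace ℝ (Fin 3) → ℝ := fun x => ‖U x - V x‖ with hD
  have hGint : Integrable G := integrable_inner_gradient hU hθs hθc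
  have hDint : IntegrableOn D {x : EuclideanSpace ℝ (Fin 3) | r₀ ≤ ‖x‖ ∧ ‖x‖ ≤ r₀ + 1} :=
    ((hU.integrableOn_isCompact (isCompact_shell r₀ (r₀ + 1))).sub
      (hV.integrableOn_compact_subset (shell_subset_ne_zero hr₀ _) (isCompact_shell r₀ (r₀ + 1)))).norm
  -- Step 1: thin shells at the sphere carry little `D`-mass
  set T : ℕ → Set (EuclideanSpace ℝ (Fin 3)) := fun k =>
    {x | r₀ ≤ ‖x‖ ∧ ‖x‖ < r₀ + 1 / ((k : ℝ) + 1)} with hT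
  have hTm : ∀ k, MeasurableSet (T k) := fun k =>
    (measurableSet_le measurable_const measurable_norm).inter
      (measurableSet_lt measurable_norm measurable_const)
  have hTanti : Antitone T := by
    intro k l hkl x hx
    refine ⟨hx.1, lt_of_lt_of_le hx.2 ?_⟩
    have : (1 : ℝ) / ((l : ℝ) + 1) ≤ 1 / ((k : ℝ) + 1) := by
      gcongr
    linarith
  have hT0 : T 0 ⊆ {x : EuclideanSpace ℝ (Fin 3) | r₀ ≤ ‖x‖ ∧ ‖x‖ ≤ r₀ + 1} := fun x hx =>
    ⟨hx.1, by have h := hx.2; norm_num at h; exact h.le⟩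
  have hTlim : Tendsto (fun k => ∫ x in T k, D x) atTop (𝓝 0) := by
    have h := tendsto_setIntegral_of_antitone hTm hTanti ⟨0, hDint.mono_set hT0⟩
    have hnull : volume (⋂ k, T k) = 0 := by
      refine measure_mono_null ?_ (Measure.addHaar_sphere volume (0 : EuclideanSpace ℝ (Fin 3)) r₀)
      intro x hx
      rw [mem_iInter] at hx
      rw [mem_sphere_zero_iff_norm]
      refine le_antisymm (le_of_forall_pos_lt_add fun ε hε => ?_) (hx 0).1
      obtain ⟨k, hk⟩ := exists_nat_one_div_lt hε
      linarith [(hx k).2]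
    rwa [setIntegral_measure_zero _ hnull] at h
  -- Step 2: `|∫ G| ≤ 2 K η` for every `η > 0`
  have hmain : ∀ η : ℝ, 0 < η → |∫ x, G x| ≤ K * (η + η) := by
    intro η hη
    obtain ⟨k, hk⟩ := (hTlim.eventually_lt_const hη).exists
    obtain ⟨N, hN1, hN2, hN3⟩ : ∃ N, d N < a ∧ s' N < r₀ + 1 / ((k : ℝ) + 1) ∧
        ∫ x in {x : EuclideanSpace ℝ (Fin 3) | a < ‖x‖ ∧ ‖x‖ < b}, ‖u N x - V x‖ < η := by
      have hrt : r₀ < r₀ + 1 / ((k : ℝ) + 1) := by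
        have : (0 : ℝ) < 1 / ((k : ℝ) + 1) := by positivity
        linarith
      obtain ⟨N, ⟨h1, h2⟩, h3⟩ := (((hd.eventually_lt_const ha0).and
        (hs'.eventually_lt_const hrt)).and
        ((hconv a b ha0 hab).eventually_lt_const hη)).exists
      exact ⟨N, h1, h2, h3⟩
    have hWo : IsOpen {x : EuclideanSpace ℝ (Fin 3) | r₀ < ‖x‖} :=
      isOpen_lt continuous_const continuous_norm
    have hW'o : IsOpen {x : EuclideanSpace ℝ (Fin 3) | d N < ‖x‖} :=
      isOpen_lt continuous_const continuous_norm
    have htsW' : tsupport θ ⊆ {x : EuclideanSpace ℝ (Fin 3) | d N < ‖x‖} := fun x hx =>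
      lt_trans hN1 (hθa x hx)
    -- the radial cut-off across the shell `s N < |x| < s' N` of the pure layer `N`
    obtain ⟨χ, ψ, hχs, hψs, hχψ, hψ01, hψc, hψs', -, hχsupp, hχgrad⟩ :=
      exists_radial_cutoff (hr₀.trans (hrs N)) (hss' N)
    have hχ1 : ContDiff ℝ 1 χ := hχs.of_le (by exact_mod_cast le_top)
    -- the layer's pairing and `∫ ⟪u_N, ∇θ⟫ = 0`
    set GN : EuclideanSpace ℝ (Fin 3) → ℝ := fun x => ⟪u N x, gradient θ x⟫ with hGN
    have hGNint : Integrable GN := by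
      have h := integrable_mul_fderiv_apply_of_tsupport_subset hW'o (hu N).continuousOn
        (f := fun _ => (1 : ℝ)) continuous_const hθs (Or.inr hθc)
        (fun x hx => htsW' hx.2)
      refine h.congr (Eventually.of_forall fun x => ?_)
      simp only [one_mul, hGN, inner_gradient_eq_fderiv]
    have hGN0 : ∫ x, GN x = 0 :=
      integral_inner_gradient_eq_zero_of_tsupport_subset hW'o (hu N) (fun x hx => hudiv N x hx)
        hθs hθc htsW'
    -- `∫ χ G = ∫ χ GN` through `-∫ θ ⟪·, ∇χ⟫`, where `U = u_N` wherever `∇χ ≠ 0`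
    have hχG : ∫ x, χ x * G x = ∫ x, χ x * GN x := by
      rw [integral_mul_inner_gradient_eq_neg hWo hUs (fun x hx => hUdiv x hx) hχ1 hθs hθc
          (fun x hx => lt_trans (hrs N) (hχsupp hx.1)),
        integral_mul_inner_gradient_eq_neg hW'o (hu N) (fun x hx => hudiv N x hx) hχ1 hθs hθc
          (fun x hx => htsW' hx.2)]
      congr 1
      refine integral_congr_ae (Eventually.of_forall fun x => ?_)
      by_cases hx : fderiv ℝ χ x = 0
      · simp [gradient, hx]
      · obtain ⟨hx1, hx2⟩ := hχgrad x hx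
        simp only [hagree N x hx1 hx2]
    -- hence `∫ G = ∫ ψ (G - GN)`
    have hχeq : ∀ x, χ x = 1 - ψ x := fun x => by linarith [hχψ x]
    have hψG : Integrable (fun x => ψ x * G x) := by
      simpa only [smul_eq_mul] using
        hGint.locallyIntegrable.integrable_smul_left_of_hasCompactSupport hψs.continuous hψc
    have hψGN : Integrable (fun x => ψ x * GN x) := by
      simpa only [smul_eq_mul] using
        hGNint.locallyIntegrable.integrable_smul_left_of_hasCompactSupport hψs.continuous hψc
    have hχGi : Integrable (fun x => χ x * G x) :=
      (hGint.sub hψG).congr (Eventually.of_forall fun x => by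
        simp only [Pi.sub_apply, hχeq x]; ring)
    have hχGNi : Integrable (fun x => χ x * GN x) :=
      (hGNint.sub hψGN).congr (Eventually.of_forall fun x => by
        simp only [Pi.sub_apply, hχeq x]; ring)
    have hsplitG : ∫ x, G x = (∫ x, χ x * G x) + ∫ x, ψ x * G x := by
      rw [← integral_add hχGi hψG]
      exact integral_congr_ae (Eventually.of_forall fun x => by
        simp only [← add_mul, hχψ x, one_mul])
    have hsplitGN : ∫ x, GN x = (∫ x, χ x * GN x) + ∫ x, ψ x * GN x := by
      rw [← integral_add hχGNi hψGN]
      exact integral_congr_ae (Eventually.of_forall fun x => by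
        simp only [← add_mul, hχψ x, one_mul])
    have hfinal : ∫ x, G x = ∫ x, ψ x * (G x - GN x) := by
      have h : ∫ x, ψ x * (G x - GN x) = (∫ x, ψ x * G x) - ∫ x, ψ x * GN x := by
        rw [← integral_sub hψG hψGN]
        exact integral_congr_ae (Eventually.of_forall fun x => by ring)
      rw [h, hsplitG, hχG]
      linarith [hsplitGN, hGN0]
    -- the bound `|ψ (G - GN)| ≤ K (1_T |U - V| + 1_A |u_N - V|)`
    set A : Set (EuclideanSpace ℝ (Fin 3)) := {x | a < ‖x‖ ∧ ‖x‖ < b} with hA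
    have hAm : MeasurableSet A :=
      (measurableSet_lt measurable_const measurable_norm).inter
        (measurableSet_lt measurable_norm measurable_const)
    set HN : EuclideanSpace ℝ (Fin 3) → ℝ := fun x => ‖u N x - V x‖ with hHN
    have hHNint : IntegrableOn HN A := by
      refine IntegrableOn.mono_set ?_ (show A ⊆ {x : EuclideanSpace ℝ (Fin 3) | a ≤ ‖x‖ ∧ ‖x‖ ≤ b}
        from fun x hx => ⟨hx.1.le, hx.2.le⟩)
      refine (Integrable.sub ?_ ?_).norm
      · exact ((hu N).continuousOn.mono fun x hx => lt_of_lt_of_le hN1 hx.1).integrableOn_compact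
          (isCompact_shell a b)
      · exact hV.integrableOn_compact_subset (shell_subset_ne_zero ha0 b) (isCompact_shell a b)
    have hDk : IntegrableOn D (T k) := hDint.mono_set ((hTanti (Nat.zero_le k)).trans hT0)
    set bound : EuclideanSpace ℝ (Fin 3) → ℝ := fun x =>
      K * ((T k).indicator D x + A.indicator HN x) with hbound
    have hbound_int : Integrable bound :=
      ((hDk.integrable_indicator (hTm k)).add (hHNint.integrable_indicator hAm)).const_mul K
    have hpt : ∀ x, ‖ψ x * (G x - GN x)‖ ≤ bound x := by
      intro x
      have hb0 : 0 ≤ bound x :=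
        mul_nonneg hK0 (add_nonneg (indicator_nonneg (fun y _ => norm_nonneg _) x)
          (indicator_nonneg (fun y _ => norm_nonneg _) x))
      by_cases hxθ : x ∈ tsupport θ
      swap
      · have h0 : G x - GN x = 0 := by
          simp only [hG, hGN, hDθ0 x hxθ, inner_zero_right, sub_self]
        rw [h0, mul_zero, norm_zero]
        exact hb0
      by_cases hψx : ψ x = 0
      · rw [hψx, zero_mul, norm_zero]
        exact hb0
      have hxs' : ‖x‖ < s' N := hψs' x hψx
      have hxA : x ∈ A := ⟨hθa x hxθ, hθb x hxθ⟩
      rw [Real.norm_eq_abs, abs_mul, abs_of_nonneg (hψ01 x).1]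
      refine le_trans (mul_le_of_le_one_left (abs_nonneg _) (hψ01 x).2) ?_
      have hdiff : G x - GN x = ⟪U x - u N x, gradient θ x⟫ := by
        simp only [hG, hGN, inner_sub_left]
      rw [hdiff]
      calc |⟪U x - u N x, gradient θ x⟫| ≤ K * ‖U x - u N x‖ := hDθ x _
        _ ≤ K * (‖U x - V x‖ + ‖u N x - V x‖) := by
            refine mul_le_mul_of_nonneg_left ?_ hK0
            calc ‖U x - u N x‖ = ‖(U x - V x) - (u N x - V x)‖ := by abel_nf
              _ ≤ ‖U x - V x‖ + ‖u N x - V x‖ := norm_sub_le _ _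
        _ ≤ bound x := by
            simp only [hbound]
            refine mul_le_mul_of_nonneg_left ?_ hK0
            rw [indicator_of_mem hxA]
            refine add_le_add ?_ le_rfl
            by_cases hxr : r₀ ≤ ‖x‖
            · rw [indicator_of_mem (show x ∈ T k from ⟨hxr, lt_trans hxs' hN2⟩)]
            · have h0 : ‖U x - V x‖ = 0 := by simp [hUV x (not_le.1 hxr)]
              rw [h0]
              exact indicator_nonneg (fun y _ => norm_nonneg _) x
    calc |∫ x, G x| = ‖∫ x, ψ x * (G x - GN x)‖ := by rw [hfinal, Real.norm_eq_abs]
      _ ≤ ∫ x, bound x := norm_integral_le_of_norm_le hbound_int (Eventually.of_forall hpt)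
      _ = K * ((∫ x in T k, D x) + ∫ x in A, HN x) := by
          simp only [hbound]
          rw [integral_const_mul, integral_add (hDk.integrable_indicator (hTm k))
            (hHNint.integrable_indicator hAm), integral_indicator (hTm k), integral_indicator hAm]
      _ ≤ K * (η + η) := by gcongr
  -- Step 3: conclusion
  refine abs_eq_zero.1 (le_antisymm (le_of_forall_pos_le_add fun ε hε => ?_) (abs_nonneg _))
  have hK1 : 0 < K + 1 := by linarith
  have h := hmain (ε / (2 * (K + 1))) (by positivity)
  calc |∫ x, G x| ≤ K * (ε / (2 * (K + 1)) + ε / (2 * (K + 1))) := h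
    _ = ε * (K / (K + 1)) := by field_simp; ring
    _ ≤ ε * 1 := by gcongr; exact (div_le_one hK1).2 (by linarith)
    _ = 0 + ε := by ring

/-- **The glued velocity is weakly divergence free on all of `ℝ³`** (clause 9 of
`stub_freeSpaceSinkCompletion` given the ladder): under the hypotheses of
`integral_inner_gradient_eq_zero_of_ladder`, if moreover `U` is measurable with
`|U|² ∈ L¹_loc(ℝ³)`, then `∫ ⟪U, ∇θ⟫ = 0` for EVERY smooth compactly supported `θ` — the sink is
a removable point (`integral_inner_gradient_eq_zero_of_puncture`, capacity zero in dimension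
three). [folklore] -/
theorem integral_inner_gradient_eq_zero_of_ladder_of_sq {r₀ : ℝ} (hr₀ : 0 < r₀)
    {V U : EuclideanSpace ℝ (Fin 3) → EuclideanSpace ℝ (Fin 3)}
    (hUm : AEStronglyMeasurable U volume)
    (hU2 : LocallyIntegrable (fun x => ‖U x‖ ^ 2) volume)
    (hV : LocallyIntegrableOn V {x | x ≠ 0} volume)
    (hUV : ∀ x, ‖x‖ < r₀ → U x = V x)
    (hUs : ContDiffOn ℝ 1 U {x | r₀ < ‖x‖})
    (hUdiv : ∀ x : EuclideanSpace ℝ (Fin 3), r₀ < ‖x‖ → VectorCalculus.divergence U x = 0)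
    {u : ℕ → EuclideanSpace ℝ (Fin 3) → EuclideanSpace ℝ (Fin 3)} {d s s' : ℕ → ℝ}
    (hu : ∀ N, ContDiffOn ℝ 1 (u N) {x | d N < ‖x‖})
    (hudiv : ∀ (N : ℕ) (x : EuclideanSpace ℝ (Fin 3)), d N < ‖x‖ →
      VectorCalculus.divergence (u N) x = 0)
    (hrs : ∀ N, r₀ < s N) (hss' : ∀ N, s N < s' N)
    (hd : Tendsto d atTop (𝓝 0)) (hs' : Tendsto s' atTop (𝓝 r₀))
    (hagree : ∀ (N : ℕ) (x : EuclideanSpace ℝ (Fin 3)), s N < ‖x‖ → ‖x‖ < s' N → U x = u N x)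
    (hconv : ∀ a b : ℝ, 0 < a → a < b → Tendsto (fun N =>
      ∫ x in {x : EuclideanSpace ℝ (Fin 3) | a < ‖x‖ ∧ ‖x‖ < b}, ‖u N x - V x‖) atTop (𝓝 0))
    {θ : EuclideanSpace ℝ (Fin 3) → ℝ} (hθ : ContDiff ℝ ∞ θ) (hθc : HasCompactSupport θ) :
    ∫ x, ⟪U x, gradient θ x⟫ = 0 :=
  integral_inner_gradient_eq_zero_of_puncture (by rw [finrank_euclideanSpace_fin]) hUm hU2
    (fun _ hθ' => integral_inner_gradient_eq_zero_of_ladder hr₀ (locallyIntegrable_of_normSq hUm hU2)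
      hV hUV hUs hUdiv hu hudiv hrs hss' hd hs' hagree hconv hθ') hθ hθc

end EulerReynoldsLadder

end Literature.Analysis.FluidPDE

end
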